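import Summits.CriticalPhenomena.CardyFormulaZ2.Theses.CardyPolygonWords
import Summits.CriticalPhenomena.CardyFormulaZ2.Theorems.CardyPolygonWordsAssembly
import HarnessLib

/-!
# Strength record for the crux `CardyOneStep` (stmt-CriticalPhenomena-4783) — Lean companion of
`STRATEGY-CENSUS.md`

Crux-strategist seat `cstrat-stmt-CriticalPhenomena-4783-r1` (planner, redirect r1, 2026-08-17),
route `CardyPolygonWords` of `CriticalPhenomena/CardyFormulaZ2`. Every typed claim of the census is
checked here, sorry-free, over landed declarations only (the route file and the landed Assembly
theorem `Theorems.CardyPolygonWords_Assembly_proof`). Nothing in this file is a new item, stub or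
line; it records the exact logical position of the crux relative to the sub-problem statement
`S = CardyFormulaZ2`:

* `cardyOneStep_of_summit` — `S → CardyOneStep` (specialisation: the crux is a CONSEQUENCE of S —
  a special case, one-step polygons with corner marks).
* `cardyRectangle_of_cardyOneStep` — `CardyOneStep → CardyRectangle` (a corner-marked rectangle is
  the degenerate one-step polygon `c = 0`, `d = a`, `b = e`): the route's rank-2 binder is
  contained in the rank-3 one, so the OPEN content of `closes` is `CardyOneStep ∧ WordSewing`.
* `summit_of_cardyOneStep_of_wordSewing`, `summit_iff_cardyOneStep_and_wordSewing` — the two open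
  binders are JOINTLY kernel-equivalent to S (a conjunct / bridge split `S ⟺ T ∧ (T → S′)` with
  `T = CardyOneStep`, `S′ = CardyLatticePolygon ≡ S` by the landed Assembly), and
  `wordSewing_iff_bridge` — `WordSewing ⟺ (CardyOneStep → S)`.
* `cardyOneStep_iff_summit_of_wordSewing` — CONDITIONAL ON the other open crux, the crux is the
  summit; unconditionally no implication `CardyOneStep → S` is in the tree (BC2/BC7 probes in the
  census: the cheap batteries and `intro h; exact?` fail with the Assembly imported), which is what
  tribunal rule T1(b) turns on.
-/

open Set Filter Topology
open Literature.Probability.RandomPlanarGeometry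
open Literature.Probability.Percolation (bondDomainCrossingProb)
open Summit.CriticalPhenomena.CardyFormulaZ2.Theses.CardyPolygonWords

namespace Summit.CriticalPhenomena.CardyFormulaZ2.Cruxes.CardyOneStep.Strength

/-- **K1 — `S → C`.** Cardy's formula in every conformal rectangle gives it in every corner-marked
one-step polygon (specialisation; the eleven binders of the crux are discarded). [folklore] -/
theorem cardyOneStep_of_summit (hS : _root_.CardyFormulaZ2) : CardyOneStep :=
  fun R _ _ _ _ _ _ _ _ _ _ => hS R

/-- **K2 — `C → CardyRectangle`.** A corner-marked rectangle `(0,a)×(0,b)` IS the degenerate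
one-step polygon with `c = 0`, `d = a`, lower height `b/2`, upper height `b/2` (carrier and marks
identities), so Cardy on one-step polygons contains Cardy on rectangles (the route's rank-2 item
stmt-CriticalPhenomena-4782). [folklore] -/
theorem cardyRectangle_of_cardyOneStep (hC : CardyOneStep) : CardyRectangle := by
  intro R a b ha hb hcar hpt
  have hb2 : (0:ℝ) < b / 2 := half_pos hb
  have hseam : max 0 (0:ℝ) < min a a := by
    rw [max_self, min_self]
    -- `0 < a`: the box is the carrier of a Jordan domain, but we also have it as a hypothesis
    exact ha
  have hcar' : R.carrier = {z : ℂ | (0 < z.re ∧ z.re < a ∧ 0 < z.im ∧ z.im < b / 2) ∨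
      ((0:ℝ) < z.re ∧ z.re < a ∧ b / 2 < z.im ∧ z.im < b / 2 + b / 2) ∨
      (max 0 (0:ℝ) < z.re ∧ z.re < min a a ∧ z.im = b / 2)} := by
    rw [hcar]
    ext z
    simp only [mem_setOf_eq, max_self, min_self, add_halves]
    constructor
    · rintro ⟨h1, h2, h3, h4⟩
      rcases lt_trichotomy z.im (b / 2) with hlt | heq | hgt
      · exact Or.inl ⟨h1, h2, h3, hlt⟩
      · exact Or.inr (Or.inr ⟨h1, h2, heq⟩)
      · exact Or.inr (Or.inl ⟨h1, h2, hgt, h4⟩)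
    · rintro (⟨h1, h2, h3, h4⟩ | ⟨h1, h2, h3, h4⟩ | ⟨h1, h2, h3⟩)
      · exact ⟨h1, h2, h3, by linarith⟩
      · exact ⟨h1, h2, by linarith, h4⟩
      · exact ⟨h1, h2, by rw [h3]; linarith, by rw [h3]; linarith⟩
  have hpt' : Set.range R.pt = {(0 : ℂ), (a : ℂ), (a : ℂ) + ((b / 2 + b / 2 : ℝ) : ℂ) * Complex.I,
      ((0 : ℝ) : ℂ) + ((b / 2 + b / 2 : ℝ) : ℂ) * Complex.I} := by
    rw [hpt, add_halves, Complex.ofReal_zero, zero_add]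
  exact hC R a (b / 2) 0 a (b / 2) hb2 hb2 hseam hcar' hpt'

/-- **K3 — `S → WordSewing`** (the sewing crux is implied by the summit outright: its conclusion
`CardyLatticePolygon` is a special case of S). [folklore] -/
theorem wordSewing_of_summit (hS : _root_.CardyFormulaZ2) : WordSewing :=
  fun _ _ R _ => hS R

/-- **K4 — the open content of `closes`.** `CardyOneStep` and `WordSewing` together give the
summit, through K2 and the LANDED Assembly (item stmt-CriticalPhenomena-4784,
`Theorems.CardyPolygonWords_Assembly_proof`); this is the route's certified `closes` with the
redundant binder `CardyRectangle` discharged by K2. [folklore] -/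
theorem summit_of_cardyOneStep_of_wordSewing (hC : CardyOneStep) (hW : WordSewing) :
    _root_.CardyFormulaZ2 :=
  Summit.CriticalPhenomena.CardyFormulaZ2.Theorems.CardyPolygonWords_Assembly_proof
    (hW (cardyRectangle_of_cardyOneStep hC) hC)

/-- **K5 — joint kernel equivalence (conjunct / bridge split).** The two open load-bearing binders
of the route are JOINTLY equivalent to the sub-problem statement: `S ⟺ CardyOneStep ∧ WordSewing`.
Tribunal T1′: the route must name the conjunct it attacks. [folklore] -/
theorem summit_iff_cardyOneStep_and_wordSewing :
    _root_.CardyFormulaZ2 ↔ (CardyOneStep ∧ WordSewing) :=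
  ⟨fun hS => ⟨cardyOneStep_of_summit hS, wordSewing_of_summit hS⟩,
    fun h => summit_of_cardyOneStep_of_wordSewing h.1 h.2⟩

/-- **K6 — the sewing crux is exactly the bridge `T → S`.** `WordSewing ⟺ (CardyOneStep → S)`
modulo the tree (K2 + landed Assembly one way, specialisation the other). [folklore] -/
theorem wordSewing_iff_bridge : WordSewing ↔ (CardyOneStep → _root_.CardyFormulaZ2) :=
  ⟨fun hW hC => summit_of_cardyOneStep_of_wordSewing hC hW,
    fun f _ hC R _ => f hC R⟩

/-- **K7 — conditional equivalence.** GIVEN the other open crux `WordSewing`, the crux IS the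
summit: `CardyOneStep ⟺ S`. Unconditionally only `S → CardyOneStep` holds in the tree (K1); no
theorem `CardyOneStep → S` exists (census §Probes), so tribunal rule T1(b) does not fire while
`WordSewing` (stmt-CriticalPhenomena-14409) is open. [folklore] -/
theorem cardyOneStep_iff_summit_of_wordSewing (hW : WordSewing) :
    CardyOneStep ↔ _root_.CardyFormulaZ2 :=
  ⟨fun hC => summit_of_cardyOneStep_of_wordSewing hC hW, cardyOneStep_of_summit⟩

/-- **K8 — the three open binders of `closes` reduce to two.** [folklore] -/
theorem closes_open_binders_iff :
    (CardyRectangle ∧ CardyOneStep ∧ WordSewing) ↔ (CardyOneStep ∧ WordSewing) :=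
  ⟨fun h => h.2, fun h => ⟨cardyRectangle_of_cardyOneStep h.1, h⟩⟩

end Summit.CriticalPhenomena.CardyFormulaZ2.Cruxes.CardyOneStep.Strength
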